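import Summits.HodgeConjecture.HodgeConjecture.Theorems.CyclicUnitaryPowersCayleyParameters

/-!
# Cayley parameters, part 2: the generic commutator identity over `ℚ`

Helper for the crux `PowersHodgeOfDeckCommutators` (stmt-HodgeConjecture-19545, route `CyclicUnitaryPowers`,
line `unitary-kunneth-fft`, stub U `stub_unitaryHodgeTensorFFT`), part 2 of 3 of the density step
(Goodman–Wallach, GTM 255, Exercises 1.4.5 #5 and §2.2.3 Exercise 1; Weyl's principle of irrelevance of
algebraic inequalities).

* §1 the Cayley transform over a field: `cayleyNum X = det(1+X) • cayley X`, `(cayley X)⁻¹ = (1+X)(1-X)⁻¹`,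
  the commutator numerator `uNum = uDen • [cayley X, cayley Y]` (`commutator_numerator`), isometry and
  commutation (`cayley_transpose_mul_mul`, `cayley_comm`);
* §2 the field step (`uDen_mul_sub_eq_zero`): under the commutator-invariance hypothesis on a coefficient tensor
  `c`, `uDen A B · ((uNum A B)^{⊗r} c − (uDen A B)^r c) = 0` for all `A, B`;
* §3 the generic identity (`innerPoly_eq_zero`): the same expression in the entries of two GENERIC matrices is the
  zero polynomial (`MvPolynomial.funext` over `ℚ`, the denominator polynomial being `1` at the origin), together
  with the evaluation formulas `aeval_innerPoly`, `aeval_denPoly` at points over any `ℚ`-algebra.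
-/

noncomputable section

open Matrix MvPolynomial
open scoped BigOperators

namespace Summit.HodgeConjecture.HodgeConjecture.Theorems.CyclicUnitaryPowersCommutatorIdentity

open Summit.HodgeConjecture.HodgeConjecture.Theorems.CyclicUnitaryPowersCayleyParameters

variable {n : Type*} [Fintype n] [DecidableEq n]

/-! ### §1 Cayley transforms over a field -/

section Field

variable {K : Type*} [Field K]

/-- `cayleyNum X = det(1+X) • cayley X` when `det(1+X)` is a unit. [cite: GoodmanWallachGTM255, Exercises 1.4.5 #5] -/
theorem cayleyNum_eq_smul_cayley (X : Matrix n n K) (h : IsUnit (1 + X).det) :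
    cayleyNum X = (1 + X).det • cayley X := by
  unfold cayleyNum cayley
  calc (1 - X) * (1 + X).adjugate
      = (1 - X) * ((1 + X)⁻¹ * ((1 + X) * (1 + X).adjugate)) := by
        rw [← Matrix.mul_assoc ((1 + X)⁻¹), Matrix.nonsing_inv_mul _ h, Matrix.one_mul]
    _ = (1 + X).det • ((1 - X) * (1 + X)⁻¹) := by
        rw [mul_adjugate, Matrix.mul_smul, Matrix.mul_one, Matrix.mul_smul]

/-- `cayley X * ((1 + X)(1 - X)⁻¹) = 1` when `det(1 ± X)` are units. [cite: GoodmanWallachGTM255, Exercises 1.4.5 #5] -/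
theorem cayley_mul_inv_candidate (X : Matrix n n K) (hp : IsUnit (1 + X).det) (hm : IsUnit (1 - X).det) :
    cayley X * ((1 + X) * (1 - X)⁻¹) = 1 := by
  unfold cayley
  calc (1 - X) * (1 + X)⁻¹ * ((1 + X) * (1 - X)⁻¹)
      = (1 - X) * ((1 + X)⁻¹ * (1 + X)) * (1 - X)⁻¹ := by simp only [Matrix.mul_assoc]
    _ = 1 := by rw [Matrix.nonsing_inv_mul _ hp, Matrix.mul_one, Matrix.mul_nonsing_inv _ hm]

/-- `(cayley X)⁻¹ = (1 + X)(1 - X)⁻¹` when `det(1 ± X)` are units. [cite: GoodmanWallachGTM255, Exercises 1.4.5 #5] -/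
theorem cayley_inv (X : Matrix n n K) (hp : IsUnit (1 + X).det) (hm : IsUnit (1 - X).det) :
    (cayley X)⁻¹ = (1 + X) * (1 - X)⁻¹ :=
  Matrix.inv_eq_right_inv (cayley_mul_inv_candidate X hp hm)

/-- `cayleyInvNum X = det(1-X) • (cayley X)⁻¹` when `det(1 ± X)` are units.
[cite: GoodmanWallachGTM255, Exercises 1.4.5 #5] -/
theorem cayleyInvNum_eq_smul_cayley_inv (X : Matrix n n K) (hp : IsUnit (1 + X).det)
    (hm : IsUnit (1 - X).det) : cayleyInvNum X = (1 - X).det • (cayley X)⁻¹ := by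
  rw [cayley_inv X hp hm]
  unfold cayleyInvNum
  calc (1 + X) * (1 - X).adjugate
      = (1 + X) * ((1 - X)⁻¹ * ((1 - X) * (1 - X).adjugate)) := by
        rw [← Matrix.mul_assoc ((1 - X)⁻¹), Matrix.nonsing_inv_mul _ hm, Matrix.one_mul]
    _ = (1 - X).det • ((1 + X) * (1 - X)⁻¹) := by
        rw [mul_adjugate, Matrix.mul_smul, Matrix.mul_one, Matrix.mul_smul]

/-- The determinant of the Cayley transform is a unit when `det(1 ± X)` are.
[cite: GoodmanWallachGTM255, Exercises 1.4.5 #5] -/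
theorem isUnit_det_cayley (X : Matrix n n K) (hp : IsUnit (1 + X).det) (hm : IsUnit (1 - X).det) :
    IsUnit (cayley X).det := by
  have h := congrArg Matrix.det (cayley_mul_inv_candidate X hp hm)
  rw [det_mul, det_one] at h
  exact IsUnit.of_mul_eq_one _ h

/-- **Commutator numerator**: for `X, Y` with `det(1 ± X), det(1 ± Y)` units,
`cayleyNum X · cayleyNum Y · cayleyInvNum X · cayleyInvNum Y = D • (g h g⁻¹ h⁻¹)` with `g, h` the Cayley
transforms and `D = det(1+X) det(1+Y) det(1-X) det(1-Y)`. [cite: GoodmanWallachGTM255, §2.2.3 Exercise 1] -/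
theorem commutator_numerator (X Y : Matrix n n K) (hXp : IsUnit (1 + X).det) (hXm : IsUnit (1 - X).det)
    (hYp : IsUnit (1 + Y).det) (hYm : IsUnit (1 - Y).det) :
    cayleyNum X * cayleyNum Y * cayleyInvNum X * cayleyInvNum Y =
      ((1 + X).det * (1 + Y).det * (1 - X).det * (1 - Y).det) •
        (cayley X * cayley Y * (cayley X)⁻¹ * (cayley Y)⁻¹) := by
  rw [cayleyNum_eq_smul_cayley X hXp, cayleyNum_eq_smul_cayley Y hYp,
    cayleyInvNum_eq_smul_cayley_inv X hXp hXm, cayleyInvNum_eq_smul_cayley_inv Y hYp hYm]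
  simp only [Matrix.smul_mul, Matrix.mul_smul, smul_smul]
  ring_nf

/-- The Cayley transform of a `G`-skew `X` preserves `G`. [cite: GoodmanWallachGTM255, Exercises 1.4.5 #5] -/
theorem cayley_transpose_mul_mul {G X : Matrix n n K} (hX : Xᵀ * G + G * X = 0)
    (hp : IsUnit (1 + X).det) : (cayley X)ᵀ * G * cayley X = G := by
  have h := cayleyNum_transpose_mul_mul (G := G) hX
  rw [cayleyNum_eq_smul_cayley X hp, transpose_smul, Matrix.smul_mul, Matrix.smul_mul, Matrix.mul_smul,
    smul_smul, ← sq] at h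
  exact smul_right_injective _ (pow_ne_zero 2 hp.ne_zero) h

/-- The Cayley transform of an `X` commuting with `S` commutes with `S`.
[cite: GoodmanWallachGTM255, §2.2.3 Exercise 1] -/
theorem cayley_comm {S X : Matrix n n K} (hX : X * S = S * X) (hp : IsUnit (1 + X).det) :
    cayley X * S = S * cayley X := by
  have h1 : (1 + X) * S = S * (1 + X) := by rw [add_mul, mul_add, one_mul, mul_one, hX]
  have h2 : (1 - X) * S = S * (1 - X) := by rw [sub_mul, mul_sub, one_mul, mul_one, hX]
  have hinv : (1 + X)⁻¹ * S = S * (1 + X)⁻¹ := by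
    calc (1 + X)⁻¹ * S = (1 + X)⁻¹ * S * ((1 + X) * (1 + X)⁻¹) := by
          rw [Matrix.mul_nonsing_inv _ hp, Matrix.mul_one]
      _ = (1 + X)⁻¹ * ((1 + X) * S) * (1 + X)⁻¹ := by rw [h1]; simp only [Matrix.mul_assoc]
      _ = S * (1 + X)⁻¹ := by rw [← Matrix.mul_assoc, Matrix.nonsing_inv_mul _ hp, Matrix.one_mul]
  unfold cayley
  rw [Matrix.mul_assoc, hinv, ← Matrix.mul_assoc, h2, Matrix.mul_assoc]

end Field

/-! ### §2 The field step: at points where the denominator is invertible the numerator is `D • [g, h]` -/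

section FieldStep

open Literature.NumberTheory.DiophantineGeometry (tensorPowerMatrix tensorPowerMatrix_apply)

variable {K : Type*} [Field K] {N : ℕ}

/-- The Kronecker power of a scalar multiple: `(d • M)^{⊗r} = d ^ r • M^{⊗r}`. [folklore] -/
theorem tensorPowerMatrix_smul (r : ℕ) (d : K) (M : Matrix (Fin N) (Fin N) K) :
    tensorPowerMatrix K N r (d • M) = d ^ r • tensorPowerMatrix K N r M := by
  ext w' w
  rw [tensorPowerMatrix_apply, Matrix.smul_apply, tensorPowerMatrix_apply, smul_eq_mul]
  simp only [Matrix.smul_apply, smul_eq_mul]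
  rw [Finset.prod_mul_distrib, Finset.prod_const, Finset.card_univ, Fintype.card_fin]

/-- **Field step.** If the coefficient tensor `c` is fixed by the Kronecker power of every commutator of
unit-determinant centraliser isometries, then for all `A, B`:
`uDen A B · ((uNum A B)^{⊗r} c − (uDen A B)^r c) = 0`. [cite: GoodmanWallachGTM255, §2.2.3 Exercise 1] -/
theorem uDen_mul_sub_eq_zero {S Si G Gi : Matrix (Fin N) (Fin N) K} {p : ℕ} (hSp : S ^ p = 1)
    (hSSi : S * Si = 1) (hSiS : Si * S = 1) (hSG : Sᵀ * G * S = G) (hGt : Gᵀ = G) (hGit : Giᵀ = Gi)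
    (hGGi : G * Gi = 1) (hGiG : Gi * G = 1) {r : ℕ} (c : (Fin r → Fin N) → K)
    (hc : ∀ g h : Matrix (Fin N) (Fin N) K, IsUnit g.det → IsUnit h.det → g * S = S * g → h * S = S * h →
      gᵀ * G * g = G → hᵀ * G * h = G → tensorPowerMatrix K N r (g * h * g⁻¹ * h⁻¹) *ᵥ c = c)
    (A B : Matrix (Fin N) (Fin N) K) (w' : Fin r → Fin N) :
    uDen S Si G Gi p A B * ((tensorPowerMatrix K N r (uNum S Si G Gi p A B) *ᵥ c) w' -
      uDen S Si G Gi p A B ^ r * c w') = 0 := by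
  by_cases hD : uDen S Si G Gi p A B = 0
  · rw [hD, zero_mul]
  · -- all four determinants are units
    have hD' := hD
    unfold uDen at hD'
    simp only [mul_eq_zero, not_or] at hD'
    obtain ⟨⟨⟨hAp, hBp⟩, hAm⟩, hBm⟩ := hD'
    set X := rho S Si G Gi p A with hXdef
    set Y := rho S Si G Gi p B with hYdef
    have hXp : IsUnit (1 + X).det := isUnit_iff_ne_zero.mpr hAp
    have hYp : IsUnit (1 + Y).det := isUnit_iff_ne_zero.mpr hBp
    have hXm : IsUnit (1 - X).det := isUnit_iff_ne_zero.mpr hAm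
    have hYm : IsUnit (1 - Y).det := isUnit_iff_ne_zero.mpr hBm
    have hnum : uNum S Si G Gi p A B =
        uDen S Si G Gi p A B • (cayley X * cayley Y * (cayley X)⁻¹ * (cayley Y)⁻¹) := by
      unfold uNum uDen
      exact commutator_numerator X Y hXp hXm hYp hYm
    have hinv := hc (cayley X) (cayley Y) (isUnit_det_cayley _ hXp hXm) (isUnit_det_cayley _ hYp hYm)
      (cayley_comm (rho_comm hSp hSSi hSiS A) hXp) (cayley_comm (rho_comm hSp hSSi hSiS B) hYp)
      (cayley_transpose_mul_mul (rho_skew hSG hSSi hGt hGit hGGi hGiG A) hXp)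
      (cayley_transpose_mul_mul (rho_skew hSG hSSi hGt hGit hGGi hGiG B) hYp)
    rw [hnum, tensorPowerMatrix_smul, Matrix.smul_mulVec, hinv, Pi.smul_apply, smul_eq_mul, sub_self,
      mul_zero]

end FieldStep

/-! ### §3 The generic identity: two generic matrices, `MvPolynomial.funext` over `ℚ` -/

section Generic

open Literature.NumberTheory.DiophantineGeometry (tensorPowerMatrix tensorPowerMatrix_apply)

variable {N : ℕ}

/-- Evaluating the first generic matrix at `pt A B` gives `A`. [folklore] -/
theorem mapMatrix_aeval_genA {K : Type*} [CommRing K] [Algebra ℚ K] (A B : Matrix (Fin N) (Fin N) K) :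
    ((MvPolynomial.aeval (pt A B) : MvPolynomial (Vars N) ℚ →ₐ[ℚ] K) : MvPolynomial (Vars N) ℚ →+* K).mapMatrix
      genA = A := by
  ext i j
  simp [genA, pt]

/-- Evaluating the second generic matrix at `pt A B` gives `B`. [folklore] -/
theorem mapMatrix_aeval_genB {K : Type*} [CommRing K] [Algebra ℚ K] (A B : Matrix (Fin N) (Fin N) K) :
    ((MvPolynomial.aeval (pt A B) : MvPolynomial (Vars N) ℚ →ₐ[ℚ] K) : MvPolynomial (Vars N) ℚ →+* K).mapMatrix
      genB = B := by
  ext i j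
  simp [genB, pt]

/-- A `ℚ`-algebra map sends `M.map (algebraMap ℚ _)` to `M.map (algebraMap ℚ _)`. [folklore] -/
theorem mapMatrix_map_algebraMap {R K : Type*} [CommRing R] [Algebra ℚ R] [CommRing K] [Algebra ℚ K]
    (f : R →ₐ[ℚ] K) (M : Matrix (Fin N) (Fin N) ℚ) :
    (f : R →+* K).mapMatrix (M.map (algebraMap ℚ R)) = M.map (algebraMap ℚ K) := by
  ext i j
  simp

/-- Evaluation of the inner polynomial at a pair of matrices over a `ℚ`-algebra.
[cite: GoodmanWallachGTM255, §2.2.3 Exercise 1] -/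
theorem aeval_innerPoly {K : Type*} [CommRing K] [Algebra ℚ K] (S Si G Gi : Matrix (Fin N) (Fin N) ℚ)
    (p r : ℕ) (c : (Fin r → Fin N) → ℚ) (w' : Fin r → Fin N) (A B : Matrix (Fin N) (Fin N) K) :
    MvPolynomial.aeval (pt A B) (innerPoly S Si G Gi p r c w') =
      (tensorPowerMatrix K N r (uNum (S.map (algebraMap ℚ K)) (Si.map (algebraMap ℚ K))
          (G.map (algebraMap ℚ K)) (Gi.map (algebraMap ℚ K)) p A B) *ᵥ (fun w => algebraMap ℚ K (c w))) w' -
        uDen (S.map (algebraMap ℚ K)) (Si.map (algebraMap ℚ K)) (G.map (algebraMap ℚ K))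
          (Gi.map (algebraMap ℚ K)) p A B ^ r * algebraMap ℚ K (c w') := by
  set f : MvPolynomial (Vars N) ℚ →ₐ[ℚ] K := MvPolynomial.aeval (pt A B) with hf
  set UP := uNum (S.map (algebraMap ℚ (MvPolynomial (Vars N) ℚ))) (Si.map (algebraMap ℚ _))
    (G.map (algebraMap ℚ _)) (Gi.map (algebraMap ℚ _)) p genA genB with hUP
  set UK := uNum (S.map (algebraMap ℚ K)) (Si.map (algebraMap ℚ K)) (G.map (algebraMap ℚ K))
    (Gi.map (algebraMap ℚ K)) p A B with hUK
  have hU : (f : MvPolynomial (Vars N) ℚ →+* K).mapMatrix UP = UK := by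
    rw [hUP, map_uNum, mapMatrix_map_algebraMap f S, mapMatrix_map_algebraMap f Si, mapMatrix_map_algebraMap f G,
      mapMatrix_map_algebraMap f Gi, mapMatrix_aeval_genA, mapMatrix_aeval_genB]
  have hD : f (uDen (S.map (algebraMap ℚ _)) (Si.map (algebraMap ℚ _)) (G.map (algebraMap ℚ _))
      (Gi.map (algebraMap ℚ _)) p genA genB) =
      uDen (S.map (algebraMap ℚ K)) (Si.map (algebraMap ℚ K)) (G.map (algebraMap ℚ K))
        (Gi.map (algebraMap ℚ K)) p A B := by
    have := map_uDen (f : MvPolynomial (Vars N) ℚ →+* K) (S.map (algebraMap ℚ _)) (Si.map (algebraMap ℚ _))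
      (G.map (algebraMap ℚ _)) (Gi.map (algebraMap ℚ _)) p genA genB
    rw [mapMatrix_map_algebraMap, mapMatrix_map_algebraMap, mapMatrix_map_algebraMap, mapMatrix_map_algebraMap,
      mapMatrix_aeval_genA, mapMatrix_aeval_genB, RingHom.coe_coe] at this
    exact this
  unfold innerPoly
  rw [← hUP, map_sub, map_mul, map_pow, AlgHom.commutes, hD]
  congr 1
  simp only [Matrix.mulVec, dotProduct, map_sum, map_mul, AlgHom.commutes]
  refine Finset.sum_congr rfl fun w _ => ?_
  congr 1
  rw [tensorPowerMatrix_apply, tensorPowerMatrix_apply, map_prod]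
  refine Finset.prod_congr rfl fun k _ => ?_
  have := congrFun (congrFun hU (w' k)) (w k)
  rw [RingHom.mapMatrix_apply, Matrix.map_apply, RingHom.coe_coe] at this
  exact this

/-- Evaluation of the denominator polynomial. [cite: GoodmanWallachGTM255, §2.2.3 Exercise 1] -/
theorem aeval_denPoly {K : Type*} [CommRing K] [Algebra ℚ K] (S Si G Gi : Matrix (Fin N) (Fin N) ℚ) (p : ℕ)
    (A B : Matrix (Fin N) (Fin N) K) :
    MvPolynomial.aeval (pt A B) (denPoly S Si G Gi p) =
      uDen (S.map (algebraMap ℚ K)) (Si.map (algebraMap ℚ K)) (G.map (algebraMap ℚ K)) (Gi.map (algebraMap ℚ K))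
        p A B := by
  set f : MvPolynomial (Vars N) ℚ →ₐ[ℚ] K := MvPolynomial.aeval (pt A B) with hf
  have := map_uDen (f : MvPolynomial (Vars N) ℚ →+* K) (S.map (algebraMap ℚ _)) (Si.map (algebraMap ℚ _))
    (G.map (algebraMap ℚ _)) (Gi.map (algebraMap ℚ _)) p genA genB
  rw [mapMatrix_map_algebraMap, mapMatrix_map_algebraMap, mapMatrix_map_algebraMap, mapMatrix_map_algebraMap,
    mapMatrix_aeval_genA, mapMatrix_aeval_genB, RingHom.coe_coe] at this
  exact this

/-- The denominator polynomial is not zero (it is `1` at the origin). [folklore] -/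
theorem denPoly_ne_zero (S Si G Gi : Matrix (Fin N) (Fin N) ℚ) (p : ℕ) : denPoly S Si G Gi p ≠ 0 := by
  intro h
  have h1 := aeval_denPoly (K := ℚ) S Si G Gi p 0 0
  rw [h, map_zero, uDen_zero] at h1
  exact zero_ne_one h1

/-- The pair-of-matrices point recovers every point of the variable space. [folklore] -/
theorem pt_of {K : Type*} (a : Vars N → K) :
    pt (Matrix.of fun i j => a (Sum.inl (i, j))) (Matrix.of fun i j => a (Sum.inr (i, j))) = a := by
  funext v
  rcases v with ⟨i, j⟩ | ⟨i, j⟩ <;> rfl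

/-- **The generic identity.** Under the commutator-invariance hypothesis on `ℚ`-points, the inner polynomial
vanishes identically. [cite: GoodmanWallachGTM255, §2.2.3 Exercise 1] -/
theorem innerPoly_eq_zero {p : ℕ} (S G : Matrix (Fin N) (Fin N) ℚ) (hp : 0 < p) (hSp : S ^ p = 1)
    (hSG : Sᵀ * G * S = G) (hGt : Gᵀ = G) (hG : IsUnit G.det) {r : ℕ} (c : (Fin r → Fin N) → ℚ)
    (hc : ∀ g h : Matrix (Fin N) (Fin N) ℚ, IsUnit g.det → IsUnit h.det → g * S = S * g → h * S = S * h →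
      gᵀ * G * g = G → hᵀ * G * h = G → tensorPowerMatrix ℚ N r (g * h * g⁻¹ * h⁻¹) *ᵥ c = c)
    (w' : Fin r → Fin N) : innerPoly S S⁻¹ G G⁻¹ p r c w' = 0 := by
  have hSdet : IsUnit S.det := by
    have h := congrArg Matrix.det hSp
    rw [det_pow, det_one] at h
    exact IsUnit.of_pow_eq_one h hp.ne'
  have hSSi : S * S⁻¹ = 1 := Matrix.mul_nonsing_inv _ hSdet
  have hSiS : S⁻¹ * S = 1 := Matrix.nonsing_inv_mul _ hSdet
  have hGGi : G * G⁻¹ = 1 := Matrix.mul_nonsing_inv _ hG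
  have hGiG : G⁻¹ * G = 1 := Matrix.nonsing_inv_mul _ hG
  have hGit : (G⁻¹)ᵀ = G⁻¹ := by rw [transpose_nonsing_inv, hGt]
  have hvanish : denPoly S S⁻¹ G G⁻¹ p * innerPoly S S⁻¹ G G⁻¹ p r c w' = 0 := by
    apply MvPolynomial.funext
    intro a
    rw [map_zero, map_mul]
    set A : Matrix (Fin N) (Fin N) ℚ := Matrix.of fun i j => a (Sum.inl (i, j)) with hA
    set B : Matrix (Fin N) (Fin N) ℚ := Matrix.of fun i j => a (Sum.inr (i, j)) with hB
    have k1 := aeval_innerPoly (K := ℚ) S S⁻¹ G G⁻¹ p r c w' A B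
    have k2 := aeval_denPoly (K := ℚ) S S⁻¹ G G⁻¹ p A B
    rw [pt_of] at k1 k2
    rw [MvPolynomial.aeval_eq_eval] at k1 k2
    rw [k1, k2]
    simp only [Algebra.algebraMap_self, RingHom.id_apply]
    exact uDen_mul_sub_eq_zero hSp hSSi hSiS hSG hGt hGit hGGi hGiG c hc A B w'
  exact (mul_eq_zero.mp hvanish).resolve_left (denPoly_ne_zero S S⁻¹ G G⁻¹ p)

end Generic

end Summit.HodgeConjecture.HodgeConjecture.Theorems.CyclicUnitaryPowersCommutatorIdentity

end
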